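import Summits.QuantumFields.YangMills.Theorems.LuscherReductionDressedRitzPolyakovLiftStaticsPositivity
import HarnessLib

/-!
# Line «polyakovlift» on crux `DressedRitz` (stmt-QuantumFields-20205), stub S-STAT `stub_liftStatics`:
# the ONE-SITE REDUCTION of the static clauses — every time-0 datum is a moment of ONE probability law on `SU(2)³`

Fleet-service module of seat ym-infvol-p1 g5 (route `LuscherReduction`, femto rung R2b1), registered line «polyakovlift» (skeleton sha16
`9b069c059f21b79f`; objects re-homed in `…DressedRitzPolyakovLiftDefs.lean`).  Companion of `…PolyakovLiftStaticsPrep.lean` (p524029) and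
`…PolyakovLiftStaticsPositivity.lean` (clause (o0) proved; `stub_liftStatics_of_o2` = the exact residual).

THE POINT.  The static clauses of the line speak about `⟨u_i, u_l⟩` with `u_i = OpPlat.ins φ (flowLiftAt x₀ t g_i) = (g_i∘Π_t − ⟨g_i∘Π_t⟩_φ)·φ`,
`Π_t = polyakovSite x₀ ∘ wilsonFlow t`.  Every such number is a MOMENT of the single probability measure

  `polyakovLaw x₀ t φ := (Π_t)_* (φ² dU)` on `GaugeConfig 3 1 SU2 = SU(2)³`

— the LAW OF THE FLOWED POLYAKOV TRIPLE in the state `φ²` (§1: `integral_polyakovLaw`, a probability measure when `‖φ‖ = 1`):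
`⟨φ, (f∘Π_t)·φ⟩ = ∫ f dν` (§2 `l2_vac_flowLiftAt_mul`), `⟨u_f, u_h⟩ = ∫ f h dν − ∫ f dν · ∫ h dν = Cov_ν(f, h)` (§2 ★ `l2_ins_flowLiftAt_eq_cov`).
Hence (§3 ★ `stub_liftStatics_of_lawCorrelation`) the registered stub S-STAT follows from — and, clause (o0) being proved, is EQUIVALENT in content to —
the purely ONE-SITE statement

  «for every `k` there are `C, lam0` such that eventually in the femto window, for every raw vacuum `φ` and every one-site eigen-ratio basis
   `(ω, g)` at `B₁ = 2/λ³`: `|Cov_ν(g_i, g_l)| ≤ C·λ·√Var_ν(g_i)·√Var_ν(g_l)` (`i ≠ l`), `ν = polyakovLaw 0 (L²/√λ) φ`»,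

i.e. the eigen-ratio observables, which are EXACTLY uncorrelated and normalised under the one-site ground law `ω²dV` (`∫ g_i g_l ω² = δ_il`,
`∫ g_i ω² = 0`), are uncorrelated to relative `O(λ)` under the vacuum law of the flowed Polyakov triple.  This is the form in which a
renormalisation-group proof (Bałaban small-field analysis + Born–Oppenheimer reduction to the zero mode) or a numerical falsifier would meet the
stub; it is an OPEN estimate (in print only as renormalised perturbation theory [Luscher1983, §3], [LuscherMunster1984, §2]).

HONEST FRAMING: measure-theoretic bookkeeping (push-forward, change of variables) on the CONDITIONAL femto rung R2b1; no RG content; nothing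
here bears on infinite volume, the continuum limit or the Clay mass gap.
References: M. Lüscher, NPB 219 (1983) 233 [cite: Luscher1983, §3]; M. Lüscher, U. Wolff, NPB 339 (1990) 222 [cite: LuscherWolff1990];
M. Lüscher, JHEP 08 (2010) 071 [cite: Luscher2010, §2].
-/

set_option autoImplicit false

noncomputable section

open MeasureTheory Filter Topology Real
open scoped NNReal ENNReal
open Literature.MathematicalPhysics.QuantumFieldTheory
open Literature.MathematicalPhysics.QuantumFieldTheory.WilsonFlow
open Literature.MathematicalPhysics.QuantumLattice
open scoped BigOperators

namespace Summit.QuantumFields.YangMills.Theorems.FemtoTransferGap.PolyakovLift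

open Summit.QuantumFields.YangMills.Theorems.FemtoTransferGap
open Summit.QuantumFields.YangMills.Theorems.FemtoTransferGap.PhysL2

/-! ## §1 The law of the flowed Polyakov triple in a state `φ²` -/

section Law

variable {L : ℕ} [NeZero L]

/-- **The law of the flowed Polyakov triple** at base point `x₀` and flow time `t` in the state `φ² dU`: the push-forward of the measure
`φ(U)² dU` (`dU` = product Haar `configMeasure`) under `Π_t = polyakovSite x₀ ∘ wilsonFlow t`, a measure on one-site configurations
`GaugeConfig 3 1 SU2 = SU(2)³`.  For a raw vacuum `φ` this is the vacuum distribution of Lüscher–Wolff's flowed Polyakov-loop triple.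
[cite: LuscherWolff1990] [cite: Luscher2010, §2] -/
def polyakovLaw (x₀ : Site 3 L) (t : ℝ) (φ : GaugeConfig 3 L SU2 → ℝ) : Measure (GaugeConfig 3 1 SU2) :=
  Measure.map (fun U : GaugeConfig 3 L SU2 => polyakovSite x₀ (wilsonFlow t U))
    ((configMeasure SU2 L).withDensity fun U => ((φ U ^ 2).toNNReal : ℝ≥0∞))

/-- `Π_t = polyakovSite x₀ ∘ wilsonFlow t` is measurable. [folklore] -/
theorem measurable_flowedPolyakovSite (x₀ : Site 3 L) (t : ℝ) :
    Measurable fun U : GaugeConfig 3 L SU2 => polyakovSite x₀ (wilsonFlow t U) := by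
  haveI : SecondCountableTopology SU2 := secondCountableTopology_su2
  exact (continuous_polyakovSite x₀).measurable.comp (measurable_wilsonFlow t)

/-- **Change of variables**: `∫ f dν = ∫ f(Π_t U) φ(U)² dU` for every bounded measurable one-site `f` (in particular every physical `f`).
[folklore] -/
theorem integral_polyakovLaw (x₀ : Site 3 L) (t : ℝ) {φ : GaugeConfig 3 L SU2 → ℝ} (hφ : IsPhys φ)
    {f : GaugeConfig 3 1 SU2 → ℝ} (hf : IsPhys f) :
    ∫ V, f V ∂(polyakovLaw x₀ t φ) =
      ∫ U, f (polyakovSite x₀ (wilsonFlow t U)) * φ U ^ 2 ∂(configMeasure SU2 L) := by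
  unfold polyakovLaw
  rw [integral_map (measurable_flowedPolyakovSite x₀ t).aemeasurable hf.measurable.aestronglyMeasurable]
  have hmeas : Measurable fun U : GaugeConfig 3 L SU2 => (φ U ^ 2).toNNReal := (hφ.measurable.pow_const 2).real_toNNReal
  rw [integral_withDensity_eq_integral_smul hmeas]
  refine integral_congr_ae (ae_of_all _ fun U => ?_)
  dsimp only
  rw [NNReal.smul_def, smul_eq_mul, Real.coe_toNNReal _ (sq_nonneg _), mul_comm]

/-- The law of the flowed Polyakov triple in a normalised state is a probability measure. [folklore] -/
theorem isProbabilityMeasure_polyakovLaw (x₀ : Site 3 L) (t : ℝ) {φ : GaugeConfig 3 L SU2 → ℝ} (hφ : IsPhys φ) (hφ1 : l2 φ φ = 1) :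
    IsProbabilityMeasure (polyakovLaw x₀ t φ) := by
  constructor
  unfold polyakovLaw
  rw [Measure.map_apply (measurable_flowedPolyakovSite x₀ t) MeasurableSet.univ, Set.preimage_univ,
    withDensity_apply _ MeasurableSet.univ, Measure.restrict_univ]
  have hint : Integrable (fun U => ((φ U ^ 2).toNNReal : ℝ)) (configMeasure SU2 L) := by
    have h := hφ.integrable_sq
    refine h.congr (ae_of_all _ fun U => ?_)
    dsimp only
    rw [Real.coe_toNNReal _ (sq_nonneg _)]
  rw [lintegral_coe_eq_integral _ hint]
  have h1 : ∫ U, ((φ U ^ 2).toNNReal : ℝ) ∂configMeasure SU2 L = 1 := by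
    rw [← hφ1]
    unfold l2
    refine integral_congr_ae (ae_of_all _ fun U => ?_)
    dsimp only
    rw [Real.coe_toNNReal _ (sq_nonneg _), sq]
  rw [h1, ENNReal.ofReal_one]

end Law

/-! ## §2 Time-0 vacuum correlators of flowed Polyakov insertions are moments of the law -/

section Moments

variable {L : ℕ} [NeZero L]

/-- `⟨φ, (f∘Π_t)·φ⟩ = ∫ f dν` — the first moment. [folklore] -/
theorem l2_vac_flowLiftAt_mul (x₀ : Site 3 L) (t : ℝ) {φ : GaugeConfig 3 L SU2 → ℝ} (hφ : IsPhys φ)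
    {f : GaugeConfig 3 1 SU2 → ℝ} (hf : IsPhys f) :
    l2 φ (flowLiftAt x₀ t f * φ) = ∫ V, f V ∂(polyakovLaw x₀ t φ) := by
  rw [integral_polyakovLaw x₀ t hφ hf]
  unfold l2
  refine integral_congr_ae (ae_of_all _ fun U => ?_)
  simp only [Pi.mul_apply, flowLiftAt]
  ring

/-- The flowed lift is multiplicative: `(fh)∘Π_t = (f∘Π_t)(h∘Π_t)`. [folklore] -/
theorem flowLiftAt_mul (x₀ : Site 3 L) (t : ℝ) (f h : GaugeConfig 3 1 SU2 → ℝ) :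
    flowLiftAt (L := L) x₀ t (f * h) = flowLiftAt x₀ t f * flowLiftAt x₀ t h := rfl

/-- ★ **`⟨u_f, u_h⟩ = Cov_ν(f, h)`**: for `‖φ‖ = 1` and physical one-site `f`, `h`, the `l2` pairing of the vacuum-subtracted flowed insertions
`OpPlat.ins φ (f∘Π_t)`, `OpPlat.ins φ (h∘Π_t)` is the covariance of `f` and `h` under the law of the flowed Polyakov triple:
`∫ f h dν − (∫ f dν)(∫ h dν)`. [cite: LuscherWolff1990] -/
theorem l2_ins_flowLiftAt_eq_cov (x₀ : Site 3 L) (t : ℝ) {φ : GaugeConfig 3 L SU2 → ℝ} (hφ : IsPhys φ) (hφ1 : l2 φ φ = 1)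
    {f h : GaugeConfig 3 1 SU2 → ℝ} (hf : IsPhys f) (hh : IsPhys h) :
    l2 (OpPlat.ins φ (flowLiftAt x₀ t f)) (OpPlat.ins φ (flowLiftAt x₀ t h)) =
      ∫ V, f V * h V ∂(polyakovLaw x₀ t φ) -
        (∫ V, f V ∂(polyakovLaw x₀ t φ)) * (∫ V, h V ∂(polyakovLaw x₀ t φ)) := by
  have hF : IsPhys (flowLiftAt (L := L) x₀ t f) := isPhys_flowLiftAt x₀ t hf
  have hH : IsPhys (flowLiftAt (L := L) x₀ t h) := isPhys_flowLiftAt x₀ t hh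
  -- the three moments
  have m1 : l2 φ (flowLiftAt x₀ t f * φ) = ∫ V, f V ∂(polyakovLaw x₀ t φ) := l2_vac_flowLiftAt_mul x₀ t hφ hf
  have m2 : l2 φ (flowLiftAt x₀ t h * φ) = ∫ V, h V ∂(polyakovLaw x₀ t φ) := l2_vac_flowLiftAt_mul x₀ t hφ hh
  have m12 : l2 (flowLiftAt x₀ t f * φ) (flowLiftAt x₀ t h * φ) = ∫ V, f V * h V ∂(polyakovLaw x₀ t φ) := by
    have h0 := l2_vac_flowLiftAt_mul x₀ t hφ (OpPlat.isPhys_mul hf hh)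
    simp only [Pi.mul_apply] at h0
    rw [← h0]
    unfold l2
    refine integral_congr_ae (ae_of_all _ fun U => ?_)
    simp only [Pi.mul_apply, flowLiftAt]
    ring
  -- bilinear expansion in the `physSubmodule` currency
  set a : ℝ := l2 φ (flowLiftAt x₀ t f * φ) with ha
  set b : ℝ := l2 φ (flowLiftAt x₀ t h * φ) with hb
  set Φ : physSubmodule L := ⟨φ, hφ⟩ with hΦ
  set Fφ : physSubmodule L := ⟨flowLiftAt x₀ t f * φ, OpPlat.isPhys_mul hF hφ⟩ with hFφ
  set Hφ : physSubmodule L := ⟨flowLiftAt x₀ t h * φ, OpPlat.isPhys_mul hH hφ⟩ with hHφ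
  have hinsF : OpPlat.ins φ (flowLiftAt x₀ t f) = ((Fφ - a • Φ : physSubmodule L) : GaugeConfig 3 L SU2 → ℝ) := by
    rw [OpPlat.ins_eq]; rfl
  have hinsH : OpPlat.ins φ (flowLiftAt x₀ t h) = ((Hφ - b • Φ : physSubmodule L) : GaugeConfig 3 L SU2 → ℝ) := by
    rw [OpPlat.ins_eq]; rfl
  have hexp : l2Form L (Fφ - a • Φ) (Hφ - b • Φ) =
      l2Form L Fφ Hφ - b * l2Form L Fφ Φ - a * l2Form L Φ Hφ + a * b * l2Form L Φ Φ := by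
    simp only [map_sub, map_smul, LinearMap.sub_apply, LinearMap.smul_apply, smul_eq_mul]
    ring
  rw [hinsF, hinsH, ← l2Form_apply, hexp]
  simp only [l2Form_apply]
  have e1 : l2 (Fφ : GaugeConfig 3 L SU2 → ℝ) Φ = a := by rw [ha, l2_comm]
  have e2 : l2 (Φ : GaugeConfig 3 L SU2 → ℝ) Hφ = b := hb.symm
  have e3 : l2 (Φ : GaugeConfig 3 L SU2 → ℝ) Φ = 1 := hφ1
  have e4 : l2 (Fφ : GaugeConfig 3 L SU2 → ℝ) Hφ = ∫ V, f V * h V ∂(polyakovLaw x₀ t φ) := m12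
  rw [e1, e2, e3, e4, ← m1, ← m2]
  ring

/-- In particular `‖u_f‖² = Var_ν(f) = ∫ f² dν − (∫ f dν)²`. [cite: LuscherWolff1990] -/
theorem l2_ins_flowLiftAt_self_eq_var (x₀ : Site 3 L) (t : ℝ) {φ : GaugeConfig 3 L SU2 → ℝ} (hφ : IsPhys φ) (hφ1 : l2 φ φ = 1)
    {f : GaugeConfig 3 1 SU2 → ℝ} (hf : IsPhys f) :
    l2 (OpPlat.ins φ (flowLiftAt x₀ t f)) (OpPlat.ins φ (flowLiftAt x₀ t f)) =
      ∫ V, f V * f V ∂(polyakovLaw x₀ t φ) - (∫ V, f V ∂(polyakovLaw x₀ t φ)) ^ 2 := by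
  rw [l2_ins_flowLiftAt_eq_cov x₀ t hφ hφ1 hf hf, sq]

end Moments

/-! ## §3 ★ S-STAT reduced to a correlation bound for ONE law on `SU(2)³` -/

section Reduction

/-- ★ **ONE-SITE REDUCTION OF S-STAT.**  The registered stub `stub_liftStatics` (its body VERBATIM, in the tree's re-homed vocabulary) follows
from the purely one-site statement: for every `k` there are `C ≥ 0`, `lam0 > 0` such that eventually in the femto window, for every raw vacuum
`φ` and every one-site eigen-ratio basis `(ω, g)` at `B₁ = liftCoupling β L = 2/λ³`, the eigen-ratios are uncorrelated to relative `O(λ)` under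
the law `ν = polyakovLaw 0 (flowTime β L) φ` of the flowed Polyakov triple:
`|∫ g_i g_l dν − ∫ g_i dν ∫ g_l dν| ≤ C·λ·√(∫ g_i² dν − (∫ g_i dν)²)·√(∫ g_l² dν − (∫ g_l dν)²)` (`i ≠ l`).
(Clause (o0) is `liftFamily_o0`; clause (o2) is this hypothesis through `l2_ins_flowLiftAt_eq_cov`.)  The hypothesis is the OPEN
renormalisation-group estimate «vacuum law of the flowed Polyakov triple = one-site ground law at the Polyakov-scale coupling, to relative
`O(λ)`, on eigen-ratio products» — Lüscher's femto-universe effective theory with non-perturbative control. [cite: Luscher1983, §3] [cite: LuscherWolff1990] -/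
theorem stub_liftStatics_of_lawCorrelation
    (hlaw : ∀ k : ℕ, ∃ C lam0 : ℝ, 0 ≤ C ∧ 0 < lam0 ∧ ∀ lam : ℝ, 0 < lam → lam ≤ lam0 → ∃ L0 : ℕ,
      ∀ (L : ℕ) [NeZero L], L0 ≤ L → ∀ β : ℝ, InFemtoWindow lam β L →
        ∀ φ : GaugeConfig 3 L SU2 → ℝ, IsRawVacuum β φ →
          ∀ (ω : GaugeConfig 3 1 SU2 → ℝ) (g : Fin k → (GaugeConfig 3 1 SU2 → ℝ)), LiftBasis (liftCoupling β L) k ω g →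
            ∀ i l : Fin k, i ≠ l →
              |∫ V, g i V * g l V ∂(polyakovLaw 0 (flowTime β L) φ) -
                  (∫ V, g i V ∂(polyakovLaw 0 (flowTime β L) φ)) * (∫ V, g l V ∂(polyakovLaw 0 (flowTime β L) φ))| ≤
                C * luscherLambda β L *
                  (Real.sqrt (∫ V, g i V * g i V ∂(polyakovLaw 0 (flowTime β L) φ) -
                      (∫ V, g i V ∂(polyakovLaw 0 (flowTime β L) φ)) ^ 2) *
                    Real.sqrt (∫ V, g l V * g l V ∂(polyakovLaw 0 (flowTime β L) φ) -
                      (∫ V, g l V ∂(polyakovLaw 0 (flowTime β L) φ)) ^ 2))) :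
    ∀ k : ℕ, ∃ C lam0 : ℝ, 0 ≤ C ∧ 0 < lam0 ∧ ∀ lam : ℝ, 0 < lam → lam ≤ lam0 → ∃ L0 : ℕ,
      ∀ (L : ℕ) [NeZero L], L0 ≤ L → ∀ β : ℝ, InFemtoWindow lam β L →
        ∀ φ : GaugeConfig 3 L SU2 → ℝ, IsRawVacuum β φ →
          ∀ (ω : GaugeConfig 3 1 SU2 → ℝ) (g : Fin k → (GaugeConfig 3 1 SU2 → ℝ)), LiftBasis (liftCoupling β L) k ω g →
            StaticClauses k C β (liftFamily β φ g) := by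
  refine stub_liftStatics_of_o2 fun k => ?_
  obtain ⟨C, lam0, hC, hlam0, h⟩ := hlaw k
  refine ⟨C, lam0, hC, hlam0, fun lam hlam hle => ?_⟩
  obtain ⟨L0, hL0⟩ := h lam hlam hle
  refine ⟨L0, fun L _ hL β hW φ hvac ω g hbasis i l hil => ?_⟩
  have hφ : IsPhys φ := hvac.1
  have hφ1 : l2 φ φ = 1 := hvac.2.1
  have hg : ∀ j, IsPhys (g j) := hbasis.2.2.2.2.1
  have h12 := l2_ins_flowLiftAt_eq_cov (0 : Site 3 L) (flowTime β L) hφ hφ1 (hg i) (hg l)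
  have h11 := l2_ins_flowLiftAt_self_eq_var (0 : Site 3 L) (flowTime β L) hφ hφ1 (hg i)
  have h22 := l2_ins_flowLiftAt_self_eq_var (0 : Site 3 L) (flowTime β L) hφ hφ1 (hg l)
  show |l2 (OpPlat.ins φ (flowLiftAt 0 (flowTime β L) (g i))) (OpPlat.ins φ (flowLiftAt 0 (flowTime β L) (g l)))| ≤
    C * luscherLambda β L *
      (Real.sqrt (l2 (OpPlat.ins φ (flowLiftAt 0 (flowTime β L) (g i))) (OpPlat.ins φ (flowLiftAt 0 (flowTime β L) (g i)))) *
        Real.sqrt (l2 (OpPlat.ins φ (flowLiftAt 0 (flowTime β L) (g l))) (OpPlat.ins φ (flowLiftAt 0 (flowTime β L) (g l)))))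
  rw [h12, h11, h22]
  exact hL0 L hL β hW φ hvac ω g hbasis i l hil

end Reduction

end Summit.QuantumFields.YangMills.Theorems.FemtoTransferGap.PolyakovLift

end
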